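import Summits.KontsevichZagierPeriods.KontsevichZagierPeriods.Theses.WZCosetWall
import Summits.KontsevichZagierPeriods.KontsevichZagierPeriods.Theorems.InverseLandauTateLiftingPullback
import Literature.NumberTheory.Transcendental.KZSubcalculusInvariants

/-!
# `ZetaTwoOddEven` (stmt-KontsevichZagierPeriods-6879, route WZCosetWall) — proof

Kontsevich–Zagier (2001, §1.2) pass from `r = [(0,1)², (xy)^{-1/2}/(1 − xy)]` to
`r' = [(0,1)², 3/(1 − xy)]` (both `= 3ζ(2) = π²/2`) by expanding a geometric series and summing
termwise. Here the passage is carried out INSIDE the four-move calculus, with no series and no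
evaluation of `ζ(2)`: write `□ = (0,1)²`, `A = [□, 1/(1 − uv)]`, `B₂ = [□, 2/(1 + uv)]`.
* The squaring map `Ψ(u,v) = (u², v²)` of `□` onto itself (injective, polynomial, Jacobian
  `4uv`) is ONE change of variables (rule (2), packaged with integrability of the pulled-back
  record by `InverseLandau.tateLifting_pullback`): `r ∼ [□, 4uv · r(u²,v²)] = [□, 4/(1 − u²v²)]`
  and `A ∼ [□, 4uv/(1 − u²v²)]`.
* Integrand additivity (rule (1)) with the pointwise identities
  `4/(1 − u²v²) = 2/(1 − uv) + 2/(1 + uv)` and `2/(1 − uv) = 2/(1 + uv) + 4uv/(1 − u²v²)` gives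
  `r ≡ 2A + B₂` and `2A ≡ B₂ + A`; integer multiples `[□, k f] ≡ k • [□, f]` are integrand
  additivity too (`KZ.IntegralRep.of_constMul_nat_sub_nsmul_mem_relations`).
* Hence `r ≡ 2A + (2A − A) = 3A ≡ [□, 3/(1 − uv)] = r'` — plain bookkeeping in the free abelian
  group `KZ.FormalRep` (`abel`), no division of relations.
-/

noncomputable section

open MeasureTheory Set
open Literature.NumberTheory.Transcendental
open Literature.ModelTheory.ExponentialFields (IsSemialgebraic)
open MvPolynomial (X)

namespace Summit.KontsevichZagierPeriods.WZCosetWall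

/-! ### The open unit square and the squaring map -/

/-- Sign bookkeeping on the open unit square: for `0 < z₀, z₁ < 1` the quantities `z₀`, `z₁`,
`1 − z₀z₁`, `1 + z₀z₁` and `1 − z₀²z₁²` are all non-zero. [folklore] -/
theorem ne_zero_of_mem_square {z : Fin 2 → ℝ}
    (hz : z ∈ {z : Fin 2 → ℝ | ∀ i, z i ∈ Set.Ioo (0:ℝ) 1}) :
    z 0 ≠ 0 ∧ z 1 ≠ 0 ∧ 1 - z 0 * z 1 ≠ 0 ∧ 1 + z 0 * z 1 ≠ 0 ∧ 1 - z 0 ^ 2 * z 1 ^ 2 ≠ 0 := by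
  have hp : 0 < z 0 * z 1 := mul_pos (hz 0).1 (hz 1).1
  have hl : z 0 * z 1 < 1 :=
    mul_lt_one_of_nonneg_of_lt_one_left (hz 0).1.le (hz 0).2 (hz 1).2.le
  have hsq : z 0 ^ 2 * z 1 ^ 2 < 1 := by
    rw [← mul_pow]
    exact pow_lt_one₀ hp.le hl two_ne_zero
  exact ⟨(hz 0).1.ne', (hz 1).1.ne', (sub_pos.2 hl).ne', (add_pos one_pos hp).ne',
    (sub_pos.2 hsq).ne'⟩

/-- `((ab)²)^{-1/2} = 1/(ab)` for `a, b > 0` (the weight `(xy)^{-1/2}` read through the squaring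
map). [folklore] -/
theorem sq_mul_sq_rpow_neg_half {a b : ℝ} (ha : 0 < a) (hb : 0 < b) :
    (a ^ 2 * b ^ 2) ^ (-(1:ℝ) / 2) = (a * b)⁻¹ := by
  rw [← mul_pow, show (-(1:ℝ)) / 2 = -(1 / 2) by ring, Real.rpow_neg (sq_nonneg _),
    ← Real.sqrt_eq_rpow, Real.sqrt_sq (mul_pos ha hb).le]

/-- The squaring map `(u_j)_j ↦ (u_j²)_j` maps the open unit square ONTO itself (the inverse on
the square is the coordinatewise square root). [folklore] -/
theorem image_sq_square :
    (fun u : Fin 2 → ℝ => fun j => u j ^ 2) '' {z : Fin 2 → ℝ | ∀ i, z i ∈ Set.Ioo (0:ℝ) 1} =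
      {z : Fin 2 → ℝ | ∀ i, z i ∈ Set.Ioo (0:ℝ) 1} := by
  ext x
  constructor
  · rintro ⟨u, hu, rfl⟩
    exact fun j => ⟨pow_pos (hu j).1 2, pow_lt_one₀ (hu j).1.le (hu j).2 two_ne_zero⟩
  · intro hx
    refine ⟨fun j => Real.sqrt (x j), fun j => ⟨Real.sqrt_pos.2 (hx j).1, ?_⟩,
      funext fun j => Real.sq_sqrt (hx j).1.le⟩
    rw [Real.sqrt_lt' one_pos, one_pow]
    exact (hx j).2

/-- The squaring map is injective on the open unit square (coordinates are positive).
[folklore] -/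
theorem injOn_sq_square :
    InjOn (fun u : Fin 2 → ℝ => fun j => u j ^ 2) {z : Fin 2 → ℝ | ∀ i, z i ∈ Set.Ioo (0:ℝ) 1} := by
  intro x hx y hy hxy
  funext j
  have h : x j ^ 2 = y j ^ 2 := congrFun hxy j
  exact (pow_left_inj₀ (hx j).1.le (hy j).1.le two_ne_zero).1 h

/-- The squaring map is a `ℚ`-semialgebraic map on every `ℚ`-semialgebraic set: its coordinates
are the polynomials `X_j²` (no Tarski–Seidenberg needed). [cite: BochnakCosteRoy1998, §2.2] -/
theorem isSemialgebraicMapOn_sq {n : ℕ} {s : Set (Fin n → ℝ)} (hs : IsSemialgebraic ℚ s) :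
    IsSemialgebraicMapOn ℚ s (fun u : Fin n → ℝ => fun j => u j ^ 2) := by
  have h := isSemialgebraicMapOn_aeval hs (fun j : Fin n => (X j ^ 2 : MvPolynomial (Fin n) ℚ))
  simpa using h

/-- The squaring map has derivative the diagonal map `diag(2u_j)` at every point
(coordinatewise `hasDerivAt_pow` composed with the projections). [folklore] -/
theorem hasFDerivAt_sq {n : ℕ} (u : Fin n → ℝ) :
    HasFDerivAt (fun u : Fin n → ℝ => fun j => u j ^ 2)
      (LinearMap.toContinuousLinearMap
        (Matrix.toLin' (Matrix.diagonal fun j : Fin n => 2 * u j))) u := by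
  refine hasFDerivAt_pi'' fun i => ?_
  have h := (hasDerivAt_pow 2 (u i)).comp_hasFDerivAt u (hasFDerivAt_apply (𝕜 := ℝ) i u)
  refine h.congr_fderiv (ContinuousLinearMap.ext fun v => ?_)
  simp [Matrix.mulVec_diagonal]

/-- On the open unit square the Jacobian `diag(2u₀, 2u₁)` of the squaring map has absolute
determinant `4u₀u₁`. [folklore] -/
theorem abs_det_sqJac {u : Fin 2 → ℝ} (hu : u ∈ {z : Fin 2 → ℝ | ∀ i, z i ∈ Set.Ioo (0:ℝ) 1}) :
    |(LinearMap.toContinuousLinearMap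
        (Matrix.toLin' (Matrix.diagonal fun j : Fin 2 => 2 * u j))).det| = 4 * u 0 * u 1 := by
  rw [LinearMap.det_toContinuousLinearMap, LinearMap.det_toLin', Matrix.det_diagonal,
    Fin.prod_univ_two, abs_of_pos (by have := (hu 0).1; have := (hu 1).1; positivity)]
  ring

/-- **The squaring move.** For every representation `g` on the open unit square `□` there is an
honest representation `R = [□, 4u₀u₁ · g(u₀², u₁²)]` with `[g] − [R] ∈ KZ.relations`: ONE change of
variables along `Ψ(u) = (u₀², u₁²)` (rule (2)), the pulled-back record and its integrability being
supplied by `InverseLandau.tateLifting_pullback`. [cite: KontsevichZagier2001, §1.2 rule (2)] -/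
theorem exists_pullback_sq (g : KZ.IntegralRep 2)
    (hg : g.domain = {z : Fin 2 → ℝ | ∀ i, z i ∈ Set.Ioo (0:ℝ) 1}) :
    ∃ R : KZ.IntegralRep 2, R.domain = {z : Fin 2 → ℝ | ∀ i, z i ∈ Set.Ioo (0:ℝ) 1} ∧
      (R.integrand = fun u => 4 * u 0 * u 1 * g.integrand (fun j => u j ^ 2)) ∧
      KZ.of g - KZ.of R ∈ KZ.relations := by
  have hS : IsSemialgebraic ℚ {z : Fin 2 → ℝ | ∀ i, z i ∈ Set.Ioo (0:ℝ) 1} :=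
    hg ▸ g.isSemialgebraic_domain
  have hJ : IsSemialgebraicFunOn ℚ {z : Fin 2 → ℝ | ∀ i, z i ∈ Set.Ioo (0:ℝ) 1}
      (fun u : Fin 2 → ℝ => 4 * u 0 * u 1) := by
    have h := isSemialgebraicFunOn_aeval hS (MvPolynomial.C 4 * X 0 * X 1 : MvPolynomial (Fin 2) ℚ)
    refine h.congr fun u _ => ?_
    simp
  exact InverseLandau.tateLifting_pullback 2 g _ (fun u j => u j ^ 2)
    (fun u => LinearMap.toContinuousLinearMap
      (Matrix.toLin' (Matrix.diagonal fun j : Fin 2 => 2 * u j)))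
    (fun u => 4 * u 0 * u 1) hS (isSemialgebraicMapOn_sq hS)
    (fun u _ => (hasFDerivAt_sq u).hasFDerivWithinAt) injOn_sq_square
    (by rw [hg]; exact image_sq_square) hJ (fun u hu => (abs_det_sqJac hu).symm)

/-! ### The honest records `A = [□, 1/(1 − uv)]` and `B₂ = [□, 2/(1 + uv)]` -/

/-- The record `A = [□, 1/(1 − uv)]` exists: its integrand is a quotient of `ℚ`-polynomials with
non-vanishing denominator on `□`, and it is absolutely integrable there because the GIVEN
representation `r' = [□, 3/(1 − uv)]` is (`A = r'/3` on `□`). [cite: KontsevichZagier2001, §1.2] -/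
theorem exists_rep_inv_one_sub (r' : KZ.IntegralRep 2)
    (hr' : r'.domain = {z : Fin 2 → ℝ | ∀ i, z i ∈ Set.Ioo (0:ℝ) 1})
    (hr'i : EqOn r'.integrand (fun z => 3 / (1 - z 0 * z 1)) r'.domain) :
    ∃ A : KZ.IntegralRep 2, A.domain = {z : Fin 2 → ℝ | ∀ i, z i ∈ Set.Ioo (0:ℝ) 1} ∧
      A.integrand = fun z => 1 / (1 - z 0 * z 1) := by
  have hS : IsSemialgebraic ℚ {z : Fin 2 → ℝ | ∀ i, z i ∈ Set.Ioo (0:ℝ) 1} :=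
    hr' ▸ r'.isSemialgebraic_domain
  have hSm : MeasurableSet {z : Fin 2 → ℝ | ∀ i, z i ∈ Set.Ioo (0:ℝ) 1} :=
    IsSemialgebraic.measurableSet_holds hS
  have h3 : IntegrableOn (fun z : Fin 2 → ℝ => 3 / (1 - z 0 * z 1)) r'.domain :=
    r'.integrableOn.congr_fun hr'i (KZ.IntegralRep.measurableSet_domain_holds r')
  rw [hr'] at h3
  have hint : IntegrableOn (fun z : Fin 2 → ℝ => 1 / (1 - z 0 * z 1))
      {z : Fin 2 → ℝ | ∀ i, z i ∈ Set.Ioo (0:ℝ) 1} :=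
    IntegrableOn.congr_fun (Integrable.const_mul h3 (1 / 3)) (fun z _ => by ring) hSm
  have hfun : IsSemialgebraicFunOn ℚ {z : Fin 2 → ℝ | ∀ i, z i ∈ Set.Ioo (0:ℝ) 1}
      (fun z : Fin 2 → ℝ => 1 / (1 - z 0 * z 1)) := by
    have h := isSemialgebraicFunOn_aeval_div_aeval hS (1 : MvPolynomial (Fin 2) ℚ)
      (1 - X 0 * X 1) (fun z hz => by simpa using (ne_zero_of_mem_square hz).2.2.1)
    refine h.congr fun z _ => ?_
    simp
  exact ⟨⟨_, _, hS, hfun, hint⟩, rfl, rfl⟩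

/-- The record `B₂ = [□, 2/(1 + uv)]` exists: rational integrand with non-vanishing denominator,
absolutely integrable on `□` as the difference `2/(1 − uv) − 4uv/(1 − u²v²)` of two integrable
functions (the double of `A` and the pull-back of `A` along the squaring map).
[cite: KontsevichZagier2001, §1.2] -/
theorem exists_rep_two_div_one_add
    (hS : IsSemialgebraic ℚ {z : Fin 2 → ℝ | ∀ i, z i ∈ Set.Ioo (0:ℝ) 1})
    (hA : IntegrableOn (fun z : Fin 2 → ℝ => 1 / (1 - z 0 * z 1))
      {z : Fin 2 → ℝ | ∀ i, z i ∈ Set.Ioo (0:ℝ) 1})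
    (hR : IntegrableOn (fun u : Fin 2 → ℝ => 4 * u 0 * u 1 * (1 / (1 - u 0 ^ 2 * u 1 ^ 2)))
      {z : Fin 2 → ℝ | ∀ i, z i ∈ Set.Ioo (0:ℝ) 1}) :
    ∃ B : KZ.IntegralRep 2, B.domain = {z : Fin 2 → ℝ | ∀ i, z i ∈ Set.Ioo (0:ℝ) 1} ∧
      B.integrand = fun z => 2 / (1 + z 0 * z 1) := by
  have hSm : MeasurableSet {z : Fin 2 → ℝ | ∀ i, z i ∈ Set.Ioo (0:ℝ) 1} :=
    IsSemialgebraic.measurableSet_holds hS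
  have hint : IntegrableOn (fun z : Fin 2 → ℝ => 2 / (1 + z 0 * z 1))
      {z : Fin 2 → ℝ | ∀ i, z i ∈ Set.Ioo (0:ℝ) 1} := by
    refine IntegrableOn.congr_fun (Integrable.sub' (Integrable.const_mul hA 2) hR)
      (fun z hz => ?_) hSm
    obtain ⟨-, -, h1, h2, h3⟩ := ne_zero_of_mem_square hz
    field_simp
    ring
  have hfun : IsSemialgebraicFunOn ℚ {z : Fin 2 → ℝ | ∀ i, z i ∈ Set.Ioo (0:ℝ) 1}
      (fun z : Fin 2 → ℝ => 2 / (1 + z 0 * z 1)) := by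
    have h := isSemialgebraicFunOn_aeval_div_aeval hS (MvPolynomial.C 2 : MvPolynomial (Fin 2) ℚ)
      (1 + X 0 * X 1) (fun z hz => by simpa using (ne_zero_of_mem_square hz).2.2.2.1)
    refine h.congr fun z _ => ?_
    simp
  exact ⟨⟨_, _, hS, hfun, hint⟩, rfl, rfl⟩

/-! ### The chain -/

/-- **`ZetaTwoOddEven`** (route WZCosetWall, stmt-KontsevichZagierPeriods-6879): a representation
`r` on the open unit square `□` with integrand `(xy)^{-1/2}/(1 − xy)` and a representation `r'` on
`□` with integrand `3/(1 − xy)` are KZ-equivalent. Proof, inside the rules and without evaluating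
`ζ(2)`: with `A = [□, 1/(1 − uv)]`, `B₂ = [□, 2/(1 + uv)]`, the squaring change of variables
(rule (2)) gives `r ∼ [□, 4/(1 − u²v²)]` and `A ∼ [□, 4uv/(1 − u²v²)]`, integrand additivity
(rule (1)) gives `[□, 4/(1 − u²v²)] ≡ 2A + B₂` and `2A ≡ B₂ + [□, 4uv/(1 − u²v²)]`, whence
`r ≡ 2A + (2A − A) = 3A ≡ r'` by bookkeeping in `KZ.FormalRep`.
[cite: KontsevichZagier2001, §1.2] -/
theorem zetaTwoOddEven_proof :
    Summit.KontsevichZagierPeriods.KontsevichZagierPeriods.Theses.WZCosetWall.ZetaTwoOddEven := by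
  intro r r' hr hri hr' hr'i
  have hS : IsSemialgebraic ℚ {z : Fin 2 → ℝ | ∀ i, z i ∈ Set.Ioo (0:ℝ) 1} :=
    hr ▸ r.isSemialgebraic_domain
  -- the honest records
  obtain ⟨A, hAd, hAi⟩ := exists_rep_inv_one_sub r' hr' hr'i
  obtain ⟨R₁, hR₁d, hR₁i, h1⟩ := exists_pullback_sq r hr
  obtain ⟨R₂, hR₂d, hR₂i, h5⟩ := exists_pullback_sq A hAd
  have hAint : IntegrableOn (fun z : Fin 2 → ℝ => 1 / (1 - z 0 * z 1))
      {z : Fin 2 → ℝ | ∀ i, z i ∈ Set.Ioo (0:ℝ) 1} := by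
    have h := A.integrableOn
    rw [hAd, hAi] at h
    exact h
  have hRint : IntegrableOn (fun u : Fin 2 → ℝ => 4 * u 0 * u 1 * (1 / (1 - u 0 ^ 2 * u 1 ^ 2)))
      {z : Fin 2 → ℝ | ∀ i, z i ∈ Set.Ioo (0:ℝ) 1} := by
    have h := R₂.integrableOn
    simp only [hR₂d, hR₂i, hAi] at h
    exact h
  obtain ⟨B₂, hB₂d, hB₂i⟩ := exists_rep_two_div_one_add hS hAint hRint
  -- integer multiples of `A` are integrand additivity
  have h3 : KZ.of (A.constMul ((2 : ℕ) : ℝ) (isAlgebraic_nat 2)) - 2 • KZ.of A ∈ KZ.relations :=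
    A.of_constMul_nat_sub_nsmul_mem_relations 2
  have h7 : KZ.of (A.constMul ((3 : ℕ) : ℝ) (isAlgebraic_nat 3)) - 3 • KZ.of A ∈ KZ.relations :=
    A.of_constMul_nat_sub_nsmul_mem_relations 3
  -- `[□, 4/(1 − u²v²)] ≡ 2A + B₂`
  have h2 : KZ.of R₁ - KZ.of (A.constMul ((2 : ℕ) : ℝ) (isAlgebraic_nat 2)) - KZ.of B₂ ∈
      KZ.relations := by
    refine KZ.integrandAddRel_subset_relations ⟨2, R₁, _, B₂,
      by rw [KZ.IntegralRep.domain_constMul, hAd, hR₁d], by rw [hB₂d, hR₁d], fun u hu => ?_, rfl⟩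
    rw [hR₁d] at hu
    obtain ⟨h0, h0', h1', h2', h3'⟩ := ne_zero_of_mem_square hu
    have hmem : (fun j => u j ^ 2) ∈ r.domain := by
      rw [hr, ← image_sq_square]
      exact mem_image_of_mem _ hu
    have e : r.integrand (fun j => u j ^ 2) =
        (u 0 ^ 2 * u 1 ^ 2) ^ (-(1:ℝ) / 2) / (1 - u 0 ^ 2 * u 1 ^ 2) := hri hmem
    simp only [hR₁i, Pi.add_apply, KZ.IntegralRep.integrand_constMul, hAi, hB₂i, e,
      sq_mul_sq_rpow_neg_half (hu 0).1 (hu 1).1, Nat.cast_ofNat]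
    field_simp
    ring
  -- `2A ≡ B₂ + [□, 4uv/(1 − u²v²)]`
  have h6 : KZ.of (A.constMul ((2 : ℕ) : ℝ) (isAlgebraic_nat 2)) - KZ.of B₂ - KZ.of R₂ ∈
      KZ.relations := by
    refine KZ.integrandAddRel_subset_relations ⟨2, _, B₂, R₂,
      by rw [KZ.IntegralRep.domain_constMul, hAd, hB₂d],
      by rw [KZ.IntegralRep.domain_constMul, hAd, hR₂d], fun u hu => ?_, rfl⟩
    rw [KZ.IntegralRep.domain_constMul, hAd] at hu
    obtain ⟨h0, h0', h1', h2', h3'⟩ := ne_zero_of_mem_square hu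
    simp only [Pi.add_apply, KZ.IntegralRep.integrand_constMul, hAi, hB₂i, hR₂i, Nat.cast_ofNat]
    field_simp
    ring
  -- `3A ≡ r'`
  have h8 : KZ.of (A.constMul ((3 : ℕ) : ℝ) (isAlgebraic_nat 3)) - KZ.of r' ∈ KZ.relations := by
    refine KZ.of_sub_of_mem_relations_of_eqOn
      (by rw [KZ.IntegralRep.domain_constMul, hAd, hr']) fun x hx => ?_
    rw [KZ.IntegralRep.domain_constMul, hAd, ← hr'] at hx
    simp only [KZ.IntegralRep.integrand_constMul, hAi, hr'i hx, Nat.cast_ofNat]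
    ring
  -- bookkeeping in the free abelian group
  have key : KZ.of r - KZ.of r' =
      (KZ.of r - KZ.of R₁) +
      (KZ.of R₁ - KZ.of (A.constMul ((2 : ℕ) : ℝ) (isAlgebraic_nat 2)) - KZ.of B₂) +
      2 • (KZ.of (A.constMul ((2 : ℕ) : ℝ) (isAlgebraic_nat 2)) - 2 • KZ.of A) -
      (KZ.of (A.constMul ((2 : ℕ) : ℝ) (isAlgebraic_nat 2)) - KZ.of B₂ - KZ.of R₂) +
      (KZ.of A - KZ.of R₂) -
      (KZ.of (A.constMul ((3 : ℕ) : ℝ) (isAlgebraic_nat 3)) - 3 • KZ.of A) +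
      (KZ.of (A.constMul ((3 : ℕ) : ℝ) (isAlgebraic_nat 3)) - KZ.of r') := by
    abel
  show KZ.of r - KZ.of r' ∈ KZ.relations
  rw [key]
  exact add_mem (sub_mem (add_mem (sub_mem (add_mem (add_mem h1 h2)
    (KZ.relations.nsmul_mem h3 2)) h6) h5) h7) h8

end Summit.KontsevichZagierPeriods.WZCosetWall

end
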